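/-
Copyright (c) 2026. Released under Apache 2.0 license.
-/
import Literature.NumberTheory.Automorphic.UnboundedDenominatorsInvariantHom
import Mathlib.GroupTheory.Perm.Cycle.Type
import Mathlib.Data.ZMod.QuotientGroup
import HarnessLib

/-!
# CDT Cor. 4.5.3 (invariant form): reduction to targets of prime order

[CalegariDimitrovTang2025, Cor. 4.5.3] is printed for classes `η ∈ H¹(Γ(N), 𝐅_ℓ)`, i.e. for homomorphisms
`θ : Γ(N) → ℤ/ℓ` with `ℓ` prime.  The tree's input (`UnboundedDenominatorsCor453Reduction`) quantifies over all
finite abelian targets `Q`.  This file shows the two are equivalent for the invariant form: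

* `cor453_invariant_form_of_prime_targets` — if every `SL₂(ℤ)`-invariant homomorphism from every `Γ(N)` to a
  finite commutative group OF PRIME ORDER is trivial on some `Γ(M)`, then the same holds for every finite
  commutative target (induction on `|Q|`: split off a subgroup `C` of prime order by Cauchy's theorem, apply
  the induction hypothesis to `θ mod C` to land in `C` on a smaller `Γ(N M₁)`, then the prime-order case).
-/

open scoped MatrixGroups

universe u

namespace Literature.NumberTheory.Automorphic

namespace UnboundedDenominators

open CongruenceSubgroup Matrix.SpecialLinearGroup ModularGroup

/-- `Γ(L) ≤ Γ(M)` for `M ∣ L`. [folklore] -/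
private theorem Gamma_le_Gamma_of_dvd' {M L : ℕ} (h : M ∣ L) : Gamma L ≤ Gamma M := by
  intro γ hγ
  obtain ⟨h00, h01, h10, h11⟩ := Gamma_mem.mp hγ
  have cast_eq : ∀ a : ℤ, ((a : ZMod L).cast : ZMod M) = (a : ZMod M) := fun a ↦
    ZMod.cast_intCast h a
  rw [Gamma_mem]
  refine ⟨?_, ?_, ?_, ?_⟩
  · rw [← cast_eq, h00, ZMod.cast_one h]
  · rw [← cast_eq, h01, ZMod.cast_zero]
  · rw [← cast_eq, h10, ZMod.cast_zero]
  · rw [← cast_eq, h11, ZMod.cast_one h]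

/-- **Reduction of the invariant form of CDT Cor. 4.5.3 to prime-order targets.**  Suppose that for every `N`
and every finite commutative group `C` of prime order, every `SL₂(ℤ)`-conjugation-invariant homomorphism
`Γ(N) → C` is trivial on some `Γ(M)`, `M ≠ 0`.  Then the same holds for every finite commutative target.
[cite: CalegariDimitrovTang2025, Corollary 4.5.3] -/
theorem cor453_invariant_form_of_prime_targets
    (h : ∀ (N : ℕ) (C : Type u) [CommGroup C] [Finite C], (Nat.card C).Prime →
      ∀ (θ : Gamma N →* C),
      (∀ (g x : SL(2, ℤ)) (hx : x ∈ Gamma N) (hgx : g * x * g⁻¹ ∈ Gamma N),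
        θ ⟨g * x * g⁻¹, hgx⟩ = θ ⟨x, hx⟩) →
      ∃ M : ℕ, M ≠ 0 ∧ ∀ (x : SL(2, ℤ)) (hx : x ∈ Gamma N), x ∈ Gamma M → θ ⟨x, hx⟩ = 1)
    (N : ℕ) (Q : Type u) [CommGroup Q] [Finite Q] (θ : Gamma N →* Q)
    (hθ : ∀ (g x : SL(2, ℤ)) (hx : x ∈ Gamma N) (hgx : g * x * g⁻¹ ∈ Gamma N),
      θ ⟨g * x * g⁻¹, hgx⟩ = θ ⟨x, hx⟩) :
    ∃ M : ℕ, M ≠ 0 ∧ ∀ (x : SL(2, ℤ)) (hx : x ∈ Gamma N), x ∈ Gamma M → θ ⟨x, hx⟩ = 1 := by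
  -- strong induction on `|Q|`, uniformly in `N`, `Q`, `θ`
  suffices key : ∀ (n : ℕ) (N : ℕ) (Q : Type u) [CommGroup Q] [Finite Q], Nat.card Q = n →
      ∀ (θ : Gamma N →* Q),
      (∀ (g x : SL(2, ℤ)) (hx : x ∈ Gamma N) (hgx : g * x * g⁻¹ ∈ Gamma N),
        θ ⟨g * x * g⁻¹, hgx⟩ = θ ⟨x, hx⟩) →
      ∃ M : ℕ, M ≠ 0 ∧ ∀ (x : SL(2, ℤ)) (hx : x ∈ Gamma N), x ∈ Gamma M → θ ⟨x, hx⟩ = 1 from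
    key _ N Q rfl θ hθ
  intro n
  induction n using Nat.strong_induction_on with
  | _ n ih =>
  intro N Q _ _ hn θ hθ
  -- the degenerate level `N = 0`
  rcases Nat.eq_zero_or_pos N with rfl | hNpos
  · refine ⟨1, one_ne_zero, fun x hx _ ↦ ?_⟩
    have hx1 : x = 1 := by simpa [Gamma_zero_bot] using hx
    have : (⟨x, hx⟩ : Gamma 0) = 1 := Subtype.ext hx1
    rw [this, map_one]
  -- `|Q| = 1`: nothing to do
  rcases Nat.lt_or_ge 1 n with hn1 | hn1
  swap
  · have hcard : Nat.card Q ≤ 1 := hn ▸ hn1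
    haveI : Subsingleton Q := (Finite.card_le_one_iff_subsingleton).mp hcard
    exact ⟨1, one_ne_zero, fun x hx _ ↦ Subsingleton.elim _ _⟩
  -- a subgroup `C` of prime order `ℓ`
  obtain ⟨ℓ, hℓ, hℓn⟩ := Nat.exists_prime_and_dvd (show n ≠ 1 by omega)
  haveI : Fact ℓ.Prime := ⟨hℓ⟩
  obtain ⟨q₀, hq₀⟩ := exists_prime_orderOf_dvd_card' (G := Q) ℓ (hn ▸ hℓn)
  set C : Subgroup Q := Subgroup.zpowers q₀ with hC
  have hCcard : Nat.card C = ℓ := by rw [hC, Nat.card_zpowers, hq₀]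
  -- induction hypothesis for `θ mod C`
  have hlt : Nat.card (Q ⧸ C) < n := by
    have hmul := Subgroup.card_eq_card_quotient_mul_card_subgroup C
    rw [hCcard, hn] at hmul
    have hpos : 0 < Nat.card (Q ⧸ C) := Nat.card_pos
    nlinarith [hℓ.two_le]
  set θ' : Gamma N →* Q ⧸ C := (QuotientGroup.mk' C).comp θ with hθ'
  have hθ'inv : ∀ (g x : SL(2, ℤ)) (hx : x ∈ Gamma N) (hgx : g * x * g⁻¹ ∈ Gamma N),
      θ' ⟨g * x * g⁻¹, hgx⟩ = θ' ⟨x, hx⟩ := by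
    intro g x hx hgx
    simp only [hθ', MonoidHom.comp_apply, hθ g x hx hgx]
  obtain ⟨M₁, hM₁, hker₁⟩ := ih _ hlt N (Q ⧸ C) rfl θ' hθ'inv
  -- on `Γ(N M₁)` the values of `θ` lie in `C`
  set N₁ : ℕ := N * M₁ with hN₁
  have hN₁N : Gamma N₁ ≤ Gamma N := Gamma_le_Gamma_of_dvd' (dvd_mul_right N M₁)
  have hN₁M₁ : Gamma N₁ ≤ Gamma M₁ := Gamma_le_Gamma_of_dvd' (dvd_mul_left M₁ N)
  have hvalC : ∀ x : Gamma N₁, θ ⟨x, hN₁N x.2⟩ ∈ C := by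
    intro x
    have h1 := hker₁ x (hN₁N x.2) (hN₁M₁ x.2)
    rwa [hθ', MonoidHom.comp_apply, QuotientGroup.mk'_apply, QuotientGroup.eq_one_iff] at h1
  set θ₁ : Gamma N₁ →* C :=
    (θ.comp (Subgroup.inclusion hN₁N)).codRestrict C (fun x ↦ hvalC x) with hθ₁
  have hθ₁apply : ∀ (x : SL(2, ℤ)) (hx : x ∈ Gamma N₁), (θ₁ ⟨x, hx⟩ : Q) = θ ⟨x, hN₁N hx⟩ :=
    fun x hx ↦ rfl
  have hθ₁inv : ∀ (g x : SL(2, ℤ)) (hx : x ∈ Gamma N₁) (hgx : g * x * g⁻¹ ∈ Gamma N₁),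
      θ₁ ⟨g * x * g⁻¹, hgx⟩ = θ₁ ⟨x, hx⟩ := by
    intro g x hx hgx
    apply Subtype.ext
    rw [hθ₁apply, hθ₁apply]
    exact hθ g x (hN₁N hx) (hN₁N hgx)
  -- the prime-order case
  haveI : Finite C := inferInstance
  obtain ⟨M₂, hM₂, hker₂⟩ := h N₁ C (by rw [hCcard]; exact hℓ) θ₁ hθ₁inv
  refine ⟨N₁ * M₂, Nat.mul_ne_zero (Nat.mul_ne_zero hNpos.ne' hM₁) hM₂, fun x hx hxM ↦ ?_⟩
  have hx₁ : x ∈ Gamma N₁ := Gamma_le_Gamma_of_dvd' (dvd_mul_right N₁ M₂) hxM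
  have hx₂ : x ∈ Gamma M₂ := Gamma_le_Gamma_of_dvd' (dvd_mul_left M₂ N₁) hxM
  have h2 := hker₂ x hx₁ hx₂
  have h3 := congrArg (fun c : C ↦ (c : Q)) h2
  simp only [hθ₁apply, OneMemClass.coe_one] at h3
  exact h3

end UnboundedDenominators

end Literature.NumberTheory.Automorphic
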